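import Mathlib
import Literature.AlgebraicGeometry.Resolution.BlowupChartRsop
import Summits.ResolutionOfSingularities.ResolutionOfSingularities.Theorems.RadicialJungCleanModelsCleanProp44LocalizationTransport
import HarnessLib

/-!
# Route `RadicialJung`, crux `CleanModels` (stmt-ResolutionOfSingularities-15917), line `Sketch` rev 35, stub 6 `stub_cleanProp44` (X44c):
# THE CHART IDENTIFICATION (census (S2)), ONE STOREY — on the tree's ABSTRACT CHART DATA (`Literature/…/BlowupChartRsop.lean`): the local ring of the
# blowing up modulo the exceptional parameter and any set of vanishing chart coordinates is a LOCALIZATION of a polynomial ring over `R/I`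

Seat decomp-res-hand-2 g22 (structural hand); sequel of ✓ `…ChartLocalization` (p838418) and ✓ `…LocalizationTransport` (p838494).  The blueprint of
hand-2 g21 (memo `Sketch-memo-hand2-g21-stubs-5-7.md`, §0 NET (S2), «EVEN SHORTER» route) for the σ-tower of memo 4e §2.5: with `R = 𝒪_{X_j,z_j}`,
`I = (t_j, v_j)` (the centre `Z_{j−1}`), `D_j = R/I = 𝒪_{Z_{j−1},z_j}`, the `v_j`-chart and the local ring `L = 𝒪_{X_{j+1},z_{j+1}}` (a localization of the
chart ring at a prime `𝔓` over `𝔪_R` — ✓ `IsBlowup.exists_chartFamily` + ✓ `exists_stalk_ringHom_of_chart`): `L/(v)` is a localization of `D_j[T]`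
(`T ↦ t_{j+1}`), and `D_{j+1} = L/(v, t_{j+1}) ≅ D_j` when `z_{j+1}` lies on `Z_j` (`t_{j+1} ∈ 𝔓`).  Here, for the abstract chart data
`(A, ψ, u, ε : (R/I)[T_j : j ≠ i] ≅ A/(ψ cᵢ), 𝔓, L)` of `BlowupChartRsop` §«abstract chart data» (general `n`, chart `i`), and the chart ideal
`K₀ = (ψ cᵢ, u_j : j ∈ J)` of a set `J` of indices `j ≠ i`:

* §1 `exists_isLocalization_quot_chart` — **THE STOREY**: `L ⧸ K₀L` is a localization of `(R/I)[T_j : j ≠ i, j ∉ J]` at some submonoid, for every algebra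
  structure sending `r̄ ↦ ψ r`, `T_j ↦ u_j` (Mathlib's instance «`L ⧸ K₀L` is a localization of `A ⧸ K₀`» + the ring isomorphism
  `A ⧸ K₀ ≅ (R/I)[T_j]/(T_J) ≅ (R/I)[T_j : j ∉ J]` through `ε` and ✓ `MvPolynomial.quotientSpanXEquiv` + ✓ `isLocalization_of_algebraMap_eq`);
  `isLocalRing_quot_chart` — it is a local ring when the `u_j`, `j ∈ J`, lie in `𝔓` (`𝔓` over `𝔪_R`).
* The two SPECIALISATIONS the σ-tower uses — `J = all` (`R/I ≅ L ⧸ K₀L`: `D_{j+1} ≅ D_j`, the invariant «`𝒪_{Z_j,z_{j+1}}` is a localization of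
  `κ(c)[u]`») and `J` missing ONE index (`L ⧸ K₀L` a localization of `K[X]`: the exceptional divisor, feeding ✓ `isLocalizationAtPrime_span_pair_of_mem` /
  ✓ `exists_prime_isLocalizationAtPrime_span`, p838494) — are in the sequel `…CleanProp44ChartStepTransport.lean` (400-line rule).

What remains of (S2) after these two files: instantiate the abstract chart data on the tree's blowings up level by level (✓ `IsBlowup.exists_chartFamily`,
✓ `exists_stalk_ringHom_of_chart`, ✓ `chartQuotEquiv`, exactly as ✓ `isRsopPart_chartFamily_reesChart` does) and check that the cocone's `eval₂` structure of
✓ `tower_face` agrees with the transported one on `κ(c)`, `u`, `T` (✓ `isLocalization_of_algebraMap_eq`).  Honest framing: OURS, commutative algebra only;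
nothing here proves X44c, any case of `CleanModels`, or resolution of singularities in characteristic `p`. [cite: StacksProject, Tag 0804, Tag 0BIQ]
[cite: Matsumura1987, Thm. 4.1–4.3] [cite: CossartPiltant2008, Prop. 4.4 (proof, p. 11)]
-/

noncomputable section

set_option linter.dupNamespace false -- mandated namespace of this single-conjunct summit

open IsLocalRing Literature.AlgebraicGeometry.Resolution

namespace Summit.ResolutionOfSingularities.ResolutionOfSingularities.Theorems.RadicialJung.CleanModels

universe u

section AbstractChart

variable {R : Type u} [CommRing R] {n : ℕ} (c : Fin n → R) (i : Fin n)
  {A : Type u} [CommRing A] (L : Type u) [CommRing L] (ψ : R →+* A) (u : Fin n → A)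
  (ε : MvPolynomial {j : Fin n // j ≠ i} (R ⧸ Ideal.span (Set.range c)) ≃+* A ⧸ Ideal.span {ψ (c i)})
  (hεC : ∀ r : R, ε (MvPolynomial.C (Ideal.Quotient.mk (Ideal.span (Set.range c)) r)) = Ideal.Quotient.mk _ (ψ r))
  (hεX : ∀ j : {j : Fin n // j ≠ i}, ε (MvPolynomial.X j) = Ideal.Quotient.mk _ (u j.1))
  (𝔓 : Ideal A) [𝔓.IsPrime] [Algebra A L] [IsLocalization.AtPrime L 𝔓]
  (sJ : Set {j : Fin n // j ≠ i}) (K₀ : Ideal A) (hK₀ : K₀ = Ideal.span {ψ (c i)} ⊔ Ideal.span ((fun j : {j : Fin n // j ≠ i} => u j.1) '' sJ))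

/-! ## §1 The storey -/

include hK₀ in
/-- The chart ideal `K₀ = (ψ cᵢ, u_j : j ∈ J)` contains the image of the centre `I`: `ψ(c_j) = ψ(cᵢ)·u_j ∈ (ψ cᵢ)`. [folklore] -/
theorem span_range_le_comap_chartIdeal (hu : ∀ j, ψ (c j) = ψ (c i) * u j) :
    Ideal.span (Set.range c) ≤ (K₀.map (algebraMap A L)).comap ((algebraMap A L).comp ψ) := by
  rw [Ideal.span_le]
  rintro _ ⟨j, rfl⟩
  rw [SetLike.mem_coe, Ideal.mem_comap, RingHom.comp_apply]
  refine Ideal.mem_map_of_mem _ ?_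
  rw [hK₀, hu j]
  exact Ideal.mem_sup_left (Ideal.mul_mem_right _ _ (Ideal.mem_span_singleton_self _))

include hεX in
/-- Through `ε`, the image of `K₀` in `A ⧸ (ψ cᵢ)` is the image of the ideal `(T_j : j ∈ J)` of the polynomial ring. [folklore] -/
theorem map_chartIdeal_eq_map_span_X :
    (Ideal.span ((fun j : {j : Fin n // j ≠ i} => u j.1) '' sJ)).map (Ideal.Quotient.mk (Ideal.span {ψ (c i)})) =
      (Ideal.span (MvPolynomial.X '' sJ : Set (MvPolynomial {j : Fin n // j ≠ i} (R ⧸ Ideal.span (Set.range c))))).map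
        (ε : MvPolynomial {j : Fin n // j ≠ i} (R ⧸ Ideal.span (Set.range c)) →+* A ⧸ Ideal.span {ψ (c i)}) := by
  rw [Ideal.map_span, Ideal.map_span, ← Set.image_comp, ← Set.image_comp]
  congr 1
  refine Set.image_congr' fun j => ?_
  simp only [Function.comp_apply, RingHom.coe_coe, hεX]

include hεC hεX 𝔓 hK₀ in
/-- **THE STOREY.**  The quotient `L ⧸ K₀L`, `K₀ = (ψ cᵢ, u_j : j ∈ J)`, is a localization of the polynomial ring `(R/I)[T_j : j ≠ i, j ∉ J]` at some
submonoid — for every algebra structure with `r̄ ↦ ψ r` and `T_j ↦ u_j`. [cite: StacksProject, Tag 0BIQ] [cite: Matsumura1987, Thm. 4.1–4.3] -/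
theorem exists_isLocalization_quot_chart
    [Algebra (MvPolynomial {j : {j : Fin n // j ≠ i} // j ∉ sJ} (R ⧸ Ideal.span (Set.range c))) (L ⧸ K₀.map (algebraMap A L))]
    (hC : ∀ r : R, algebraMap (MvPolynomial {j : {j : Fin n // j ≠ i} // j ∉ sJ} (R ⧸ Ideal.span (Set.range c))) (L ⧸ K₀.map (algebraMap A L))
        (MvPolynomial.C (Ideal.Quotient.mk (Ideal.span (Set.range c)) r)) = Ideal.Quotient.mk _ (algebraMap A L (ψ r)))
    (hX : ∀ j : {j : {j : Fin n // j ≠ i} // j ∉ sJ},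
      algebraMap (MvPolynomial {j : {j : Fin n // j ≠ i} // j ∉ sJ} (R ⧸ Ideal.span (Set.range c))) (L ⧸ K₀.map (algebraMap A L))
        (MvPolynomial.X j) = Ideal.Quotient.mk _ (algebraMap A L (u j.1.1))) :
    ∃ M : Submonoid (MvPolynomial {j : {j : Fin n // j ≠ i} // j ∉ sJ} (R ⧸ Ideal.span (Set.range c))),
      IsLocalization M (L ⧸ K₀.map (algebraMap A L)) := by
  classical
  -- (a) `L ⧸ K₀L` is a localization of `A ⧸ K₀`
  have hQ₀ : IsLocalization (Algebra.algebraMapSubmonoid (A ⧸ K₀) 𝔓.primeCompl) (L ⧸ K₀.map (algebraMap A L)) := inferInstance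
  -- (b) `A ⧸ K₀ ≅ (A ⧸ KA) ⧸ KJ' ≅ P ⧸ (T_J) ≅ PJ`
  have hmapJ := map_chartIdeal_eq_map_span_X c i ψ u ε hεX sJ
  let e1 : (A ⧸ Ideal.span {ψ (c i)}) ⧸ (Ideal.span ((fun j : {j : Fin n // j ≠ i} => u j.1) '' sJ)).map
      (Ideal.Quotient.mk (Ideal.span {ψ (c i)})) ≃+* A ⧸ K₀ :=
    (DoubleQuot.quotQuotEquivQuotSup _ _).trans (Ideal.quotEquivOfEq hK₀.symm)
  let e2 : MvPolynomial {j : Fin n // j ≠ i} (R ⧸ Ideal.span (Set.range c)) ⧸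
      Ideal.span (MvPolynomial.X '' sJ : Set (MvPolynomial {j : Fin n // j ≠ i} (R ⧸ Ideal.span (Set.range c)))) ≃+*
      (A ⧸ Ideal.span {ψ (c i)}) ⧸ (Ideal.span ((fun j : {j : Fin n // j ≠ i} => u j.1) '' sJ)).map (Ideal.Quotient.mk (Ideal.span {ψ (c i)})) :=
    Ideal.quotientEquiv _ _ ε hmapJ
  let e3 : (MvPolynomial {j : Fin n // j ≠ i} (R ⧸ Ideal.span (Set.range c)) ⧸
      Ideal.span (MvPolynomial.X '' sJ : Set (MvPolynomial {j : Fin n // j ≠ i} (R ⧸ Ideal.span (Set.range c))))) ≃+*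
      MvPolynomial {j : {j : Fin n // j ≠ i} // j ∉ sJ} (R ⧸ Ideal.span (Set.range c)) :=
    (MvPolynomial.quotientSpanXEquiv sJ).toRingEquiv
  let e : A ⧸ K₀ ≃+* MvPolynomial {j : {j : Fin n // j ≠ i} // j ∉ sJ} (R ⧸ Ideal.span (Set.range c)) := e1.symm.trans (e2.symm.trans e3)
  have he1 : ∀ a : A, e1.symm (Ideal.Quotient.mk K₀ a) = Ideal.Quotient.mk _ (Ideal.Quotient.mk (Ideal.span {ψ (c i)}) a) := by
    intro a; subst hK₀; rfl
  have heC : ∀ r : R, e (Ideal.Quotient.mk K₀ (ψ r)) = MvPolynomial.C (Ideal.Quotient.mk (Ideal.span (Set.range c)) r) := by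
    intro r
    change e3 (e2.symm (e1.symm (Ideal.Quotient.mk K₀ (ψ r)))) = _
    rw [he1, ← hεC, Ideal.quotientEquiv_symm_mk, RingEquiv.symm_apply_apply]
    exact MvPolynomial.quotientSpanXEquiv_mk_C sJ _
  have heX : ∀ j : {j : {j : Fin n // j ≠ i} // j ∉ sJ}, e (Ideal.Quotient.mk K₀ (u j.1.1)) = MvPolynomial.X j := by
    intro j
    change e3 (e2.symm (e1.symm (Ideal.Quotient.mk K₀ (u j.1.1)))) = _
    rw [he1, ← hεX, Ideal.quotientEquiv_symm_mk, RingEquiv.symm_apply_apply]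
    exact MvPolynomial.quotientSpanXEquiv_mk_X sJ j.2
  -- (c) base change along `e`
  have hloc := IsLocalization.isLocalization_of_base_ringEquiv (Algebra.algebraMapSubmonoid (A ⧸ K₀) 𝔓.primeCompl)
    (L ⧸ K₀.map (algebraMap A L)) e
  refine ⟨(Algebra.algebraMapSubmonoid (A ⧸ K₀) 𝔓.primeCompl).map e.toMonoidHom, isLocalization_of_algebraMap_eq _ _ _ (fun x => ?_) hloc⟩
  -- (d) the two algebra maps agree on `r̄` and on the variables
  change ((algebraMap (A ⧸ K₀) (L ⧸ K₀.map (algebraMap A L))).comp e.symm.toRingHom) x = algebraMap _ (L ⧸ K₀.map (algebraMap A L)) x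
  revert x
  rw [← RingHom.ext_iff]
  refine MvPolynomial.ringHom_ext (fun r => ?_) (fun j => ?_)
  · obtain ⟨r, rfl⟩ := Ideal.Quotient.mk_surjective r
    rw [RingHom.comp_apply, hC r, RingEquiv.toRingHom_eq_coe, RingEquiv.coe_toRingHom, ← heC, RingEquiv.symm_apply_apply]
    exact Ideal.Quotient.algebraMap_quotient_map_quotient _
  · rw [RingHom.comp_apply, hX j, RingEquiv.toRingHom_eq_coe, RingEquiv.coe_toRingHom, ← heX, RingEquiv.symm_apply_apply]
    exact Ideal.Quotient.algebraMap_quotient_map_quotient _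

variable [IsLocalRing R] (h𝔓 : 𝔓.comap ψ = maximalIdeal R)

include h𝔓 hK₀ in
omit [𝔓.IsPrime] in
/-- The chart ideal `K₀ = (ψ cᵢ, u_j : j ∈ J)` lies in `𝔓` when the `u_j` do (`ψ cᵢ ∈ 𝔓` as `𝔓` lies over `𝔪_R ∋ cᵢ`). [folklore] -/
theorem chartIdeal_le_prime (hci : c i ∈ maximalIdeal R) (hJ : ∀ j ∈ sJ, u j.1 ∈ 𝔓) : K₀ ≤ 𝔓 := by
  rw [hK₀]
  refine sup_le ?_ ?_
  · rw [Ideal.span_singleton_le_iff_mem, ← Ideal.mem_comap, h𝔓]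
    exact hci
  · rw [Ideal.span_le]
    rintro _ ⟨j, hj, rfl⟩
    exact hJ j hj

include h𝔓 hK₀ in
/-- **`L ⧸ K₀L` is a local ring** when `K₀ ⊆ 𝔓` (quotient of the local ring `L = A_𝔓` by a proper ideal). [folklore] -/
theorem isLocalRing_quot_chart (hci : c i ∈ maximalIdeal R) (hJ : ∀ j ∈ sJ, u j.1 ∈ 𝔓) : IsLocalRing (L ⧸ K₀.map (algebraMap A L)) := by
  haveI := IsLocalization.AtPrime.isLocalRing L 𝔓
  have hle : K₀.map (algebraMap A L) ≤ maximalIdeal L := by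
    rw [Ideal.map_le_iff_le_comap]
    intro a ha
    rw [Ideal.mem_comap]
    exact (IsLocalization.AtPrime.to_map_mem_maximal_iff L 𝔓 a).mpr (chartIdeal_le_prime c i ψ u 𝔓 sJ K₀ hK₀ h𝔓 hci hJ ha)
  haveI : Nontrivial (L ⧸ K₀.map (algebraMap A L)) :=
    Ideal.Quotient.nontrivial_iff.mpr (fun h => (maximalIdeal.isMaximal L).ne_top (top_le_iff.mp (h ▸ hle)))
  exact IsLocalRing.of_surjective' (Ideal.Quotient.mk _) Ideal.Quotient.mk_surjective

end AbstractChart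

end Summit.ResolutionOfSingularities.ResolutionOfSingularities.Theorems.RadicialJung.CleanModels

end
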